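import Literature.NumberTheory.EllipticCurves.DeShalit1987.RayClassFieldPAdicReading
import Literature.NumberTheory.EllipticCurves.DeShalit1987.CMFormalActionReadingSeries
import Literature.NumberTheory.EllipticCurves.X049IntegralModelReadings
import Literature.NumberTheory.ComplexMultiplication.EllipticUnits.GrossencharacterFrobeniusInverse
import Literature.NumberTheory.ComplexMultiplication.EllipticUnits.LatticeRepsPermutation
import Literature.NumberTheory.ComplexMultiplication.EllipticUnits.DeShalitDivisionPointsLattice
import HarnessLib

/-!
# The theta datum OVER THE `𝔓`-ADIC READING RING: the «theta datum over `R`» binder block of the (α)-bridge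
# `exists_unit_forall_relColemanSeries_eq_subst_subst_of_thetaReadings` (B10f-d), instantiated at `R := 𝒪_{F,(𝔓)} = DeShalit1987.readingRing E hE`
# and discharged (de Shalit II §4.4 (25), II §4.9 (i)(ii); proofs only)

Cell `bsd-print-cf2`, width seat `bsd-line-cf2-p1-w7` g16 (piece (RP)-THETA-DATUM, part 2 of 2; part 1 is `…SeamCMDatumReading`); `--supports`
stmt-BirchSwinnertonDyer-24720 (helper, Theses-free).  THEOREMS ONLY; no `def`, no named fact, no `sorry`.

WHAT.  B10f-d (`…KatzMeasureJZeroSeam.exists_unit_forall_relColemanSeries_eq_subst_subst_of_thetaReadings`, p768701) produces the bridge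
identity (hβ) for a family of units from READINGS, over an abstract data ring `R` with a `𝔓`-adic reading `ψ : R → 𝒪_E`, an algebraic reading
`j : R → K̄` (`ψ = ι_v ∘ j`), an inverse Frobenius `τ` (`φ⁻¹ ∘ ψ = ψ ∘ τ`), the theta data `K_c, x₀, y₀, x₁, y₁, α_R, x_c` and units `u_c = x₀ − x_c`,
the permutation `e` of the `𝔞`-division values with `τ(x_c) = x_{e c}`, and the `τ`-orbit of the base point.  THIS FILE fixes, for a caller-chosen
READING LEVEL `K(𝔣_ψ𝔠_r)` read into a finite normal `E/K_v` (`hE`; `v ∤ 𝔣_ψ𝔠_r`; `𝔠_r ⊆ 𝔪`, `𝔠_r ⊆ 𝔞_i` for every index `i`),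
`R := readingRing E hE`, `ψ := readingHom E hE`, `j := (K(𝔣_ψ𝔠_r) ⊂ K̄) ∘ subtype`, `ι_v := absClosureEmbedding K K_v`, `τ := (readingFrob E hE …)⁻¹`,
and PROVES the existence of `x₀ y₀ x₁ y₁ α_R K_c x u e` with EVERY clause hψj · hu · hKj · hxj · hx₀ · hy₀ · hx₁ · hy₁ · hαj · hτ · hKτ · heT · hinj ·
hsurj · hxτ · hτx₀ · hτy₀ of B10f-d in its token shapes (★★★ `exists_thetaDatum_readingRing`), from:
* the reciprocity clauses (vi)/(vii) of de Shalit II.1.5 at `(𝔣_ψ, 𝔠_r)` AS HYPOTHESES (the last clause of the named fact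
  `DeShalit1987.prop15_grossencharacterReciprocity`, B6-style), `ψ(v) = π₀` (PSI-PIN) and `β_K π₀ ≡ 1 (mod 𝔠_r)`;
* the algebraic theta data `X₀, Y₀, X₁, Y₁, X_c ∈ K(𝔣_ψ𝔠_r)` with their MODEL-coordinate values under `ι̂` and their `𝔓`-integrality /
  unit statements (`∈ readingRing E hE`, `‖e(X₀ − X_c)‖ = 1` — de Shalit II.4.9 (i); HYPOTHESES here, to be discharged by reduction theory),
  and the theta constants `K_c ∈ K` (`v`-integral).
The proofs instantiate (RP) `RayClassFieldPAdicReading` (ring, readings, Frobenius), B6 `GrossencharacterFrobeniusInverse`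
(`algClosureEmb_iterate_model_eq`, the `τ`-orbit and one Frobenius step) and `LatticeRepsPermutation` (the permutation `e` and `hxτ`).
The companion `…SeamCMDatumReading.exists_cmDatum_readingRing` takes the outputs `x₀ y₀ x₁ y₁ α_R` with the value clauses proved here and
supplies the remaining CM block (`T`, `P_r`, `Q_r`, `hidX`, `hidY`, …) of B10f-d.

HONEST FRAMING: plumbing of accepted kernel theorems; the reciprocity law and the integrality statements are HYPOTHESES; nothing is closed;
no summit statement is proved by this seat; BSD is not proved by any of this.

## References
* [deShalit1987] E. de Shalit, *Iwasawa theory of elliptic curves with complex multiplication* (1987), II §1.5 (vi)(vii), II §4.2 (p. 56),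
  II §4.4 (25), II §4.9 Proposition (i)(ii) (p. 62–63).
* [Shimura1971] G. Shimura, *Introduction to the Arithmetic Theory of Automorphic Functions* (1971), Thm. 5.3, Prop. 7.40.
-/

-- the summit namespace `Summit.BirchSwinnertonDyer.BirchSwinnertonDyer` repeats the problem name by design (D-0017)
set_option linter.dupNamespace false
set_option autoImplicit false

noncomputable section

open scoped Classical
open scoped NumberField PeriodPair
open PeriodPair Literature.NumberTheory.EllipticCurves Literature.NumberTheory.EllipticCurves.DeShalit1987
open Literature.NumberTheory.ComplexMultiplication.EllipticUnits
open NumberField Field IsDedekindDomain IsDedekindDomain.HeightOneSpectrum ValuativeRel PowerSeries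
open Literature.NumberTheory.NumberFields
open Literature.NumberTheory.GaloisRepresentations Literature.NumberTheory.GaloisRepresentations.IsNonarchimedeanLocalField
  Literature.NumberTheory.GaloisRepresentations.LubinTate _root_.WeierstrassCurve
open Literature.NumberTheory.LFunctions.AbelianDensity (artinSymbol)

namespace Summit.BirchSwinnertonDyer.BirchSwinnertonDyer.Theorems.PrintCf2.KatzMeasureJZeroSeam

attribute [local instance] ltNormUniformSpace ltNormIsUniformAddGroup rk1 nF nE fintypeResidueField

set_option maxHeartbeats 400000 in
/-- ★★★ **The theta datum over the `𝔓`-adic reading ring** — see the module docstring.  The conclusion lists, for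
`R := readingRing E hE`, `ψ := readingHom E hE`, `j := (K(𝔣_ψ𝔠_r) ⊂ K̄) ∘ subtype`, `ι_v := absClosureEmbedding K K_v`,
`τ := (readingFrob E hE h𝔪r hv𝔪r)⁻¹`, witnesses `x₀ y₀ x₁ y₁ αR Kc x uc eι` and the clauses
hψj · hu · hKj · hxj · hx₀ · hy₀ · hx₁ · hy₁ · hαj · hτ · hKτ · heT · hinj · hsurj · hxτ · hτx₀ · hτy₀ of B10f-d (`…of_thetaReadings`) at `F := K_v`.
(Heartbeats raised to `400000` for the size of the statement only; every step is a direct instantiation.)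
[cite: deShalit1987, II §1.5 (vi)(vii), II §4.4 (25), II §4.9 (i)(ii) (p. 62–63)] [cite: Shimura1971, Thm. 5.3, Prop. 7.40] -/
theorem exists_thetaDatum_readingRing
    -- the base field, the split prime `v ∣ 2` of degree one, the embedding
    {K : Type} [Field K] [NumberField K] {v : HeightOneSpectrum (𝓞 K)} (ι : K →+* ℂ)
    -- the reading level `K(𝔣ψ 𝔠r)` and the reading field `E ⊇ e(K(𝔣ψ 𝔠r))`
    {𝔣ψ 𝔠r : Ideal (𝓞 K)}
    (E : IntermediateField (v.adicCompletion K) (AlgebraicClosure (v.adicCompletion K)))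
    [FiniteDimensional (v.adicCompletion K) E] [Normal (v.adicCompletion K) E]
    (hE : ∀ y : AlgebraicClosure K, y ∈ rayClassField K (𝔣ψ * 𝔠r) → absClosureEmbedding K (v.adicCompletion K) y ∈ E)
    (h𝔪r : 𝔣ψ * 𝔠r ≠ ⊥) (hv𝔪r : ¬ 𝔣ψ * 𝔠r ≤ v.asIdeal)
    {σ₀ : absoluteGaloisGroup (v.adicCompletion K)} (hσ₀ : IsAbsArithFrob σ₀)
    -- the integer model (only its `b₂/12`, `a₁`, `a₃` enter, through the MODEL coordinates)
    (W : WeierstrassCurve ℤ) (hW : W = ⟨1, -1, 0, -2, -1⟩)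
    -- the split prime generator and its inverse modulo the reading level
    {π₀ βK : 𝓞 K} (hβK : βK * π₀ - 1 ∈ 𝔠r)
    -- the reciprocity law II.1.5 (vi)/(vii) at `(𝔣ψ, 𝔠r)` and `ψ(v) = π₀`
    (ψK : Ideal (𝓞 K) → 𝓞 K) (hψv : ψK v.asIdeal = π₀)
    -- the lattices: `L = Ω·ι(𝔪)`, `La i = 𝔞_i⁻¹L` with representatives `S i`
    {𝔪 : Ideal (𝓞 K)} (h𝔪1 : 𝔪 ≠ ⊤) (h𝔠𝔪 : 𝔠r ≤ 𝔪)
    {J : Type*} (𝔞 : J → Ideal (𝓞 K)) (h𝔠𝔞 : ∀ i, 𝔠r ≤ 𝔞 i)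
    (L : PeriodPair) (La : J → PeriodPair) (S : J → Finset ℂ) {Ω : ℂ} (hS : ∀ i, L.IsLatticeReps (La i) (S i))
    (hLa : ∀ i, (La i).lattice = idealInvLattice ι (𝔞 i) L.lattice)
    (hL : ∀ z : ℂ, z ∈ L.lattice ↔ ∃ a ∈ 𝔪, z = Ω * ι (a : K)) (hΩ : Ω ≠ 0)
    (hvi : ∀ z : ℂ, z ∈ idealInvLattice ι 𝔠r L.lattice → z ∉ L.lattice →
      ∃ x y : rayClassField K (𝔣ψ * 𝔠r), algClosureEmb ι x = ℘[L] z ∧ algClosureEmb ι y = ℘'[L] z)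
    (hvii : ∀ z : ℂ, z ∈ idealInvLattice ι 𝔠r L.lattice → z ∉ L.lattice → ∀ x y : rayClassField K (𝔣ψ * 𝔠r),
      algClosureEmb ι x = ℘[L] z → algClosureEmb ι y = ℘'[L] z →
        algClosureEmb ι (artinSymbol (galFrob K (rayClassField K (𝔣ψ * 𝔠r))) v.asIdeal x) = ℘[L] (ι (ψK v.asIdeal : K) * z) ∧
        algClosureEmb ι (artinSymbol (galFrob K (rayClassField K (𝔣ψ * 𝔠r))) v.asIdeal y) = ℘'[L] (ι (ψK v.asIdeal : K) * z))
    -- the algebraic theta data at the reading level, with MODEL-coordinate values and `𝔓`-integrality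
    (X₀ Y₀ X₁ Y₁ : rayClassField K (𝔣ψ * 𝔠r))
    (hX₀ : algClosureEmb ι X₀ = ℘[L] Ω - (W.baseChange ℂ).b₂ / 12)
    (hY₀ : algClosureEmb ι Y₀ = (℘'[L] Ω - (W.baseChange ℂ).a₁ * (℘[L] Ω - (W.baseChange ℂ).b₂ / 12) - (W.baseChange ℂ).a₃) / 2)
    (hX₁ : algClosureEmb ι X₁ = ℘[L] (ι (π₀ : K) * Ω) - (W.baseChange ℂ).b₂ / 12)
    (hY₁ : algClosureEmb ι Y₁ = (℘'[L] (ι (π₀ : K) * Ω) - (W.baseChange ℂ).a₁ * (℘[L] (ι (π₀ : K) * Ω) - (W.baseChange ℂ).b₂ / 12) -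
      (W.baseChange ℂ).a₃) / 2)
    (hX₀i : X₀ ∈ readingRing E hE) (hY₀i : Y₀ ∈ readingRing E hE) (hX₁i : X₁ ∈ readingRing E hE) (hY₁i : Y₁ ∈ readingRing E hE)
    (KcK : J → K) (hKcK : ∀ i, ι (KcK i) = L.deltaRatio (La i) * (L.g₂ ^ 3 - 27 * L.g₃ ^ 2) ^ ((S i).card - 1))
    (hKci : ∀ i, algebraMap K (v.adicCompletion K) (KcK i) ∈ 𝒪[v.adicCompletion K])
    (Xc : J → ℂ → rayClassField K (𝔣ψ * 𝔠r))
    (hXc : ∀ i, ∀ c ∈ (S i).erase 0, algClosureEmb ι (Xc i c) = ℘[L] c - (W.baseChange ℂ).b₂ / 12)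
    (hXci : ∀ i c, Xc i c ∈ readingRing E hE)
    (hXcu : ∀ i, ∀ c ∈ (S i).erase 0, ‖(readingFieldHom E hE (X₀ - Xc i c) : E)‖ = 1) :
    ∃ (x₀ y₀ x₁ y₁ αR : readingRing E hE) (Kc : J → readingRing E hE) (x : J → ℂ → readingRing E hE)
      (uc : J → ℂ → (readingRing E hE)ˣ) (eι : J → ℂ → ℂ),
      -- hψj
      (∀ r : readingRing E hE, ((((readingHom E hE r : unitBall E) : E) : AlgebraicClosure (v.adicCompletion K))) =
        (absClosureEmbedding K (v.adicCompletion K)).toRingHom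
          (((algebraMap (rayClassField K (𝔣ψ * 𝔠r)) (AlgebraicClosure K)).comp (readingRing E hE).subtype) r)) ∧
      -- hu
      (∀ i, ∀ c ∈ (S i).erase 0, (uc i c : readingRing E hE) = x₀ - x i c) ∧
      -- hKj
      (∀ i, algClosureEmb ι (((algebraMap (rayClassField K (𝔣ψ * 𝔠r)) (AlgebraicClosure K)).comp (readingRing E hE).subtype) (Kc i)) =
        L.deltaRatio (La i) * (L.g₂ ^ 3 - 27 * L.g₃ ^ 2) ^ ((S i).card - 1)) ∧
      -- hxj
      (∀ i, ∀ c ∈ (S i).erase 0,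
        algClosureEmb ι (((algebraMap (rayClassField K (𝔣ψ * 𝔠r)) (AlgebraicClosure K)).comp (readingRing E hE).subtype) (x i c)) =
          ℘[L] c - (W.baseChange ℂ).b₂ / 12) ∧
      -- hx₀
      (algClosureEmb ι (((algebraMap (rayClassField K (𝔣ψ * 𝔠r)) (AlgebraicClosure K)).comp (readingRing E hE).subtype) x₀) =
        ℘[L] Ω - (W.baseChange ℂ).b₂ / 12) ∧
      -- hy₀
      (algClosureEmb ι (((algebraMap (rayClassField K (𝔣ψ * 𝔠r)) (AlgebraicClosure K)).comp (readingRing E hE).subtype) y₀) =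
        (℘'[L] Ω - (W.baseChange ℂ).a₁ * (℘[L] Ω - (W.baseChange ℂ).b₂ / 12) - (W.baseChange ℂ).a₃) / 2) ∧
      -- hx₁
      (algClosureEmb ι (((algebraMap (rayClassField K (𝔣ψ * 𝔠r)) (AlgebraicClosure K)).comp (readingRing E hE).subtype) x₁) =
        ℘[L] (ι (π₀ : K) * Ω) - (W.baseChange ℂ).b₂ / 12) ∧
      -- hy₁
      (algClosureEmb ι (((algebraMap (rayClassField K (𝔣ψ * 𝔠r)) (AlgebraicClosure K)).comp (readingRing E hE).subtype) y₁) =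
        (℘'[L] (ι (π₀ : K) * Ω) - (W.baseChange ℂ).a₁ * (℘[L] (ι (π₀ : K) * Ω) - (W.baseChange ℂ).b₂ / 12) -
          (W.baseChange ℂ).a₃) / 2) ∧
      -- hαj
      (algClosureEmb ι (((algebraMap (rayClassField K (𝔣ψ * 𝔠r)) (AlgebraicClosure K)).comp (readingRing E hE).subtype) αR) =
        ι (π₀ : K)) ∧
      -- hτ
      (((frobUnitBall E σ₀).symm : unitBall E →+* unitBall E).comp (readingHom E hE) =
        (readingHom E hE).comp ((readingFrob E hE h𝔪r hv𝔪r).symm : readingRing E hE →+* readingRing E hE)) ∧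
      -- hKτ
      (∀ i, ((readingFrob E hE h𝔪r hv𝔪r).symm : readingRing E hE →+* readingRing E hE) (Kc i) = Kc i) ∧
      -- heT, hinj, hsurj
      (∀ i, ∀ c ∈ (S i).erase 0, eι i c ∈ (S i).erase 0) ∧
      (∀ i, Set.InjOn (eι i) ((S i).erase 0 : Finset ℂ)) ∧
      (∀ i, Set.SurjOn (eι i) ((S i).erase 0 : Finset ℂ) ((S i).erase 0 : Finset ℂ)) ∧
      -- hxτ
      (∀ i, ∀ c ∈ (S i).erase 0, ((readingFrob E hE h𝔪r hv𝔪r).symm : readingRing E hE →+* readingRing E hE) (x i c) = x i (eι i c)) ∧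
      -- hτx₀
      (∀ m : ℕ, algClosureEmb ι (((algebraMap (rayClassField K (𝔣ψ * 𝔠r)) (AlgebraicClosure K)).comp (readingRing E hE).subtype)
          ((((readingFrob E hE h𝔪r hv𝔪r).symm : readingRing E hE →+* readingRing E hE))^[m + 1] x₀)) =
        ℘[L] (ι ((βK ^ (m + 1) : 𝓞 K) : K) * Ω) - (W.baseChange ℂ).b₂ / 12) ∧
      -- hτy₀
      (∀ m : ℕ, algClosureEmb ι (((algebraMap (rayClassField K (𝔣ψ * 𝔠r)) (AlgebraicClosure K)).comp (readingRing E hE).subtype)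
          ((((readingFrob E hE h𝔪r hv𝔪r).symm : readingRing E hE →+* readingRing E hE))^[m + 1] y₀)) =
        (℘'[L] (ι ((βK ^ (m + 1) : 𝓞 K) : K) * Ω) -
          (W.baseChange ℂ).a₁ * (℘[L] (ι ((βK ^ (m + 1) : 𝓞 K) : K) * Ω) - (W.baseChange ℂ).b₂ / 12) - (W.baseChange ℂ).a₃) / 2) := by
  classical
  subst hW
  -- ### the model `[1,−1,0,−2,−1]` over `ℂ`
  have hbc : ((⟨1, -1, 0, -2, -1⟩ : WeierstrassCurve ℤ).baseChange ℂ) = (⟨1, -1, 0, -2, -1⟩ : WeierstrassCurve ℂ) :=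
    cm7Model_map _
  have hb12 : (⟨1, -1, 0, -2, -1⟩ : WeierstrassCurve ℂ).b₂ / 12 = -1 / 4 := cm7Model_b₂_div_twelve
  have hb12f : ((⟨1, -1, 0, -2, -1⟩ : WeierstrassCurve ℤ).baseChange ℂ).b₂ / 12 = -1 / 4 := by rw [hbc, hb12]
  have ha1f : ((⟨1, -1, 0, -2, -1⟩ : WeierstrassCurve ℤ).baseChange ℂ).a₁ = 1 := by rw [hbc]
  have ha3f : ((⟨1, -1, 0, -2, -1⟩ : WeierstrassCurve ℤ).baseChange ℂ).a₃ = 0 := by rw [hbc]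
  have ha1 : (⟨1, -1, 0, -2, -1⟩ : WeierstrassCurve ℂ).a₁ = 1 := rfl
  have ha3 : (⟨1, -1, 0, -2, -1⟩ : WeierstrassCurve ℂ).a₃ = 0 := rfl
  have hX₀c := hX₀; have hY₀c := hY₀; have hXcc := hXc
  rw [hbc] at hX₀c hY₀c hXcc
  -- ### lattice facts
  have hΛ : IsCMLattice ι L.lattice := isCMLattice_of_model ι hL
  have hΛa : ∀ i, IsCMLattice ι (La i).lattice := fun i a z hz ↦ by
    rw [hLa] at hz ⊢
    exact mem_idealInvLattice_iff.mpr fun b hb ↦ by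
      rw [mul_left_comm]; exact hΛ a _ (mem_idealInvLattice_iff.mp hz b hb)
  have hΩL : Ω ∉ L.lattice := notMem_lattice_of_model ι hL hΩ h𝔪1
  have hΩinv : Ω ∈ idealInvLattice ι 𝔠r L.lattice :=
    mem_idealInvLattice_iff.mpr fun a ha ↦ mem_idealInvLattice_iff.mp (mem_idealInvLattice_of_model ι hL) a (h𝔠𝔪 ha)
  have hcinv : ∀ i, ∀ c ∈ (S i).erase 0, c ∈ idealInvLattice ι 𝔠r L.lattice := fun i c hc ↦ by
    have h1 : c ∈ (La i).lattice := (hS i).mem (Finset.mem_of_mem_erase hc)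
    rw [hLa] at h1
    exact mem_idealInvLattice_iff.mpr fun a ha ↦ mem_idealInvLattice_iff.mp h1 a (h𝔠𝔞 i ha)
  have hcL : ∀ i, ∀ c ∈ (S i).erase 0, c ∉ L.lattice := fun i c hc hcL ↦ by
    obtain ⟨hc0, hcS⟩ := Finset.mem_erase.mp hc
    exact hc0 ((hS i).distinct c hcS 0 (hS i).zero_mem (by rwa [sub_zero]))
  -- `βK` inverts `ψ(v) = π₀` modulo `𝔠r`
  have hβ : βK * ψK v.asIdeal - 1 ∈ 𝔠r := by rw [hψv]; exact hβK
  -- ### the reading `φ = ι̂ ∘ j` is injective and extends `ι`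
  have hφapp : ∀ r : readingRing E hE,
      ((algClosureEmb ι).comp ((algebraMap (rayClassField K (𝔣ψ * 𝔠r)) (AlgebraicClosure K)).comp (readingRing E hE).subtype)) r =
        algClosureEmb ι ((r : rayClassField K (𝔣ψ * 𝔠r)) : AlgebraicClosure K) := fun r ↦ rfl
  have hjapp : ∀ r : readingRing E hE,
      ((algebraMap (rayClassField K (𝔣ψ * 𝔠r)) (AlgebraicClosure K)).comp (readingRing E hE).subtype) r =
        ((r : rayClassField K (𝔣ψ * 𝔠r)) : AlgebraicClosure K) := fun r ↦ rfl
  have hφ : Function.Injective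
      ((algClosureEmb ι).comp ((algebraMap (rayClassField K (𝔣ψ * 𝔠r)) (AlgebraicClosure K)).comp (readingRing E hE).subtype)) :=
    (algClosureEmb ι).injective.comp ((algebraMap (rayClassField K (𝔣ψ * 𝔠r)) (AlgebraicClosure K)).injective.comp
      Subtype.val_injective)
  have hφK : ∀ (t : K) (ht : algebraMap K (rayClassField K (𝔣ψ * 𝔠r)) t ∈ readingRing E hE),
      ((algClosureEmb ι).comp ((algebraMap (rayClassField K (𝔣ψ * 𝔠r)) (AlgebraicClosure K)).comp (readingRing E hE).subtype))
        ⟨algebraMap K (rayClassField K (𝔣ψ * 𝔠r)) t, ht⟩ = ι t := fun t ht ↦ by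
    rw [hφapp]
    change algClosureEmb ι (algebraMap (rayClassField K (𝔣ψ * 𝔠r)) (AlgebraicClosure K)
      (algebraMap K (rayClassField K (𝔣ψ * 𝔠r)) t)) = ι t
    rw [← IsScalarTower.algebraMap_apply, algClosureEmb_algebraMap]
  have hι4 : ι (-1 / 4 : K) = -1 / 4 := by rw [map_div₀, map_neg, map_one, map_ofNat]
  -- ### the witnesses in `R`
  have hαi : algebraMap K (rayClassField K (𝔣ψ * 𝔠r)) (π₀ : K) ∈ readingRing E hE := by
    refine mem_readingRing_of_isIntegral E hE ?_
    change IsIntegral ℤ (algebraMap K (AlgebraicClosure K) (π₀ : K))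
    exact (RingOfIntegers.isIntegral_coe π₀).algebraMap
  have hα : ((algClosureEmb ι).comp ((algebraMap (rayClassField K (𝔣ψ * 𝔠r)) (AlgebraicClosure K)).comp (readingRing E hE).subtype))
      ⟨algebraMap K (rayClassField K (𝔣ψ * 𝔠r)) (π₀ : K), hαi⟩ = ι (π₀ : K) := hφK _ hαi
  have hKi : ∀ i, algebraMap K (rayClassField K (𝔣ψ * 𝔠r)) (KcK i) ∈ readingRing E hE := fun i ↦
    algebraMap_mem_readingRing_of_mem_integer E hE (hKci i)
  -- ### the `τ`-orbit of the base point (B6, de Shalit II.4.4 (25))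
  have hX₀' : algClosureEmb ι (((⟨X₀, hX₀i⟩ : readingRing E hE) : rayClassField K (𝔣ψ * 𝔠r)) : AlgebraicClosure K) =
      ℘[L] Ω - ι (-1 / 4 : K) := by
    rw [hι4]; exact hX₀c.trans (by rw [hb12])
  have hY₀' : algClosureEmb ι (((⟨Y₀, hY₀i⟩ : readingRing E hE) : rayClassField K (𝔣ψ * 𝔠r)) : AlgebraicClosure K) =
      (℘'[L] Ω - ι (1 : K) * (℘[L] Ω - ι (-1 / 4 : K)) - ι (0 : K)) / 2 := by
    rw [hι4, map_one, map_zero]; exact hY₀c.trans (by rw [hb12, ha1, ha3])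
  have horbit := fun n : ℕ ↦ algClosureEmb_iterate_model_eq ι hΛ hvi hvii hβ hΩinv hΩL (R := readingRing E hE)
    (((readingFrob E hE h𝔪r hv𝔪r).symm : readingRing E hE →+* readingRing E hE) : readingRing E hE → readingRing E hE)
    (fun r ↦ (r : rayClassField K (𝔣ψ * 𝔠r))) (fun _ ↦ rfl) (-1 / 4 : K) (1 : K) (0 : K) hX₀' hY₀' n
  -- ### the permutation of the `𝔞_i`-division values (de Shalit II.4.9 (ii))
  have hγδ : ∀ i, ∀ z ∈ (La i).lattice, ι ((βK * π₀ : 𝓞 K) : K) * z - z ∈ L.lattice := fun i z hz ↦ by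
    rw [hLa] at hz
    have h1 := mem_idealInvLattice_iff.mp hz _ (h𝔠𝔞 i hβK)
    convert h1 using 1
    push_cast
    simp only [map_mul, map_one, map_sub]
    ring
  have hperm := fun i ↦ exists_perm_of_mul_inv ι (hS i) hΛ (hΛa i) (hγδ i)
  choose eι heT heL hinj hsurj using hperm
  -- one Frobenius step on `x_c = ℘(c) − b₂/12`
  have hstep : ∀ i, ∀ c ∈ (S i).erase 0,
      algClosureEmb ι (((galFrob K (rayClassField K (𝔣ψ * 𝔠r)) v).symm (Xc i c) : rayClassField K (𝔣ψ * 𝔠r)) :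
        AlgebraicClosure K) = ℘[L] (ι (βK : K) * c) - (⟨1, -1, 0, -2, -1⟩ : WeierstrassCurve ℂ).b₂ / 12 := by
    intro i c hc
    obtain ⟨x', y', hx', hy'⟩ := hvi c (hcinv i c hc) (hcL i c hc)
    -- `ι̂(q) = 1/4` for the constant `q = 1/4 ∈ K ⊂ K(𝔣ψ𝔠r)`
    have hq : ∀ w : rayClassField K (𝔣ψ * 𝔠r), w = algebraMap K (rayClassField K (𝔣ψ * 𝔠r)) (1 / 4 : K) →
        algClosureEmb ι (w : AlgebraicClosure K) = 1 / 4 := by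
      rintro w rfl
      change algClosureEmb ι (algebraMap (rayClassField K (𝔣ψ * 𝔠r)) (AlgebraicClosure K)
        (algebraMap K (rayClassField K (𝔣ψ * 𝔠r)) (1 / 4 : K))) = 1 / 4
      rw [← IsScalarTower.algebraMap_apply, algClosureEmb_algebraMap, map_div₀, map_one, map_ofNat]
    -- the unshifted coordinate `x̃ = X_c − 1/4` reads `℘(c)`
    have hxc'' : algClosureEmb ι (((Xc i c - algebraMap K (rayClassField K (𝔣ψ * 𝔠r)) (1 / 4 : K) :
        rayClassField K (𝔣ψ * 𝔠r))) : AlgebraicClosure K) = ℘[L] c := by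
      have e : (((Xc i c - algebraMap K (rayClassField K (𝔣ψ * 𝔠r)) (1 / 4 : K) : rayClassField K (𝔣ψ * 𝔠r))) :
          AlgebraicClosure K) = (Xc i c : AlgebraicClosure K) -
            ((algebraMap K (rayClassField K (𝔣ψ * 𝔠r)) (1 / 4 : K) : rayClassField K (𝔣ψ * 𝔠r)) : AlgebraicClosure K) := rfl
      rw [e, map_sub, hq _ rfl, hXcc i c hc, hb12]
      ring
    have h1 := (algClosureEmb_galFrob_symm_eq ι hΛ hvi hvii hβ (hcinv i c hc) (hcL i c hc) hxc'' hy').1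
    rw [map_sub, AlgEquiv.commutes] at h1
    have e' : ((((galFrob K (rayClassField K (𝔣ψ * 𝔠r)) v).symm (Xc i c) -
          algebraMap K (rayClassField K (𝔣ψ * 𝔠r)) (1 / 4 : K) : rayClassField K (𝔣ψ * 𝔠r))) : AlgebraicClosure K) =
        (((galFrob K (rayClassField K (𝔣ψ * 𝔠r)) v).symm (Xc i c) : rayClassField K (𝔣ψ * 𝔠r)) : AlgebraicClosure K) -
          ((algebraMap K (rayClassField K (𝔣ψ * 𝔠r)) (1 / 4 : K) : rayClassField K (𝔣ψ * 𝔠r)) : AlgebraicClosure K) := rfl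
    rw [e', map_sub, hq _ rfl] at h1
    rw [hb12]
    linear_combination h1
  have hxτ : ∀ i, ∀ c ∈ (S i).erase 0,
      ((readingFrob E hE h𝔪r hv𝔪r).symm : readingRing E hE →+* readingRing E hE) ⟨Xc i c, hXci i c⟩ =
        ⟨Xc i (eι i c), hXci i (eι i c)⟩ := fun i ↦
    apply_eq_of_readings ι
      ((algClosureEmb ι).comp ((algebraMap (rayClassField K (𝔣ψ * 𝔠r)) (AlgebraicClosure K)).comp (readingRing E hE).subtype))
      hφ (((readingFrob E hE h𝔪r hv𝔪r).symm : readingRing E hE →+* readingRing E hE))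
      (fun c ↦ (⟨Xc i c, hXci i c⟩ : readingRing E hE)) ((⟨1, -1, 0, -2, -1⟩ : WeierstrassCurve ℂ).b₂ / 12)
      (heT i) (heL i) (fun c hc ↦ by rw [hφapp]; exact hXcc i c hc) (fun c hc ↦ by rw [hφapp]; exact hstep i c hc)
  -- ### the units `u_c = x₀ − x_c` (de Shalit II.4.9 (i))
  have huc : ∀ i c, ∃ w : (readingRing E hE)ˣ, c ∈ (S i).erase 0 →
      (w : readingRing E hE) = (⟨X₀, hX₀i⟩ : readingRing E hE) - ⟨Xc i c, hXci i c⟩ := by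
    intro i c
    by_cases hc : c ∈ (S i).erase 0
    · have e : ((((⟨X₀, hX₀i⟩ : readingRing E hE) - ⟨Xc i c, hXci i c⟩ : readingRing E hE)) : rayClassField K (𝔣ψ * 𝔠r)) =
          X₀ - Xc i c := AddSubgroupClass.coe_sub _ _
      exact ⟨(isUnit_readingRing_of_norm_eq_one E hE ((⟨X₀, hX₀i⟩ : readingRing E hE) - ⟨Xc i c, hXci i c⟩)
        (by rw [e]; exact hXcu i c hc)).unit, fun _ ↦ IsUnit.unit_spec _⟩
    · exact ⟨1, fun h ↦ (hc h).elim⟩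
  choose uc huc using huc
  -- ### assembly
  refine ⟨⟨X₀, hX₀i⟩, ⟨Y₀, hY₀i⟩, ⟨X₁, hX₁i⟩, ⟨Y₁, hY₁i⟩, ⟨algebraMap K (rayClassField K (𝔣ψ * 𝔠r)) (π₀ : K), hαi⟩,
    fun i ↦ ⟨algebraMap K (rayClassField K (𝔣ψ * 𝔠r)) (KcK i), hKi i⟩, fun i c ↦ ⟨Xc i c, hXci i c⟩, uc, eι,
    ?_, ?_, ?_, ?_, ?_, ?_, ?_, ?_, ?_, ?_, ?_, ?_, ?_, ?_, ?_, ?_, ?_⟩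
  · -- hψj
    exact fun _ ↦ rfl
  · -- hu
    exact fun i c hc ↦ huc i c hc
  · -- hKj
    exact fun i ↦ (hφK _ (hKi i)).trans (hKcK i)
  · -- hxj
    exact fun i c hc ↦ hXc i c hc
  · -- hx₀
    exact hX₀
  · -- hy₀
    exact hY₀
  · -- hx₁
    exact hX₁
  · -- hy₁
    exact hY₁
  · -- hαj
    exact hα
  · -- hτ
    exact RingHom.ext fun r ↦ frobUnitBall_symm_readingHom E hE h𝔪r hv𝔪r hσ₀ r
  · -- hKτ
    exact fun i ↦ Subtype.ext (AlgEquiv.commutes _ _)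
  · -- heT
    exact heT
  · -- hinj
    exact hinj
  · -- hsurj
    exact hsurj
  · -- hxτ
    exact hxτ
  · -- hτx₀
    intro m
    exact (congrArg (algClosureEmb ι) (hjapp _)).trans (((horbit (m + 1)).1).trans (by rw [hι4, hb12f]))
  · -- hτy₀
    intro m
    exact (congrArg (algClosureEmb ι) (hjapp _)).trans (((horbit (m + 1)).2).trans (by rw [hι4, map_one ι, map_zero ι, hb12f, ha1f, ha3f]))
end Summit.BirchSwinnertonDyer.BirchSwinnertonDyer.Theorems.PrintCf2.KatzMeasureJZeroSeam

end
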